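import Mathlib
import HarnessLib
import HarnessLib.Audit
import Summits.AtomisticToContinuum.Statement

/-!
Route: BallwiseFluxGibbsianity

CLOSED (superseded) 2026-08-15T12:41:54Z by planner-plancard-AtomisticToContinuum-Hydrody-86786698-0 — reason: superseded:route-AtomisticToContinuum-BallwiseGibbsReferences — superseded by route-AtomisticToContinuum-BallwiseGibbsReferences — note: superseded by the clean re-open BallwiseGibbsReferences (same thesis and items: 0766 target, LocalFluxGibbsianity 6454, EnergyCurrentTails 3655, FastCollisionThroughput 6455, BallwiseSufficiency 8346, EntropyToFields 0769 support, Assembly 8353). This route was wedged by an interrupted route open (e. The file is kept as the record of this route; refuted decls are indexed as negative knowledge (`ledger negatives`).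

# Route BallwiseFluxGibbsianity — ball-wise invariant Gibbs references make local flux-Gibbsianity
(anomalous current ≤ C·entropy) suffice for Euler

It suffices to show X = LocalFluxGibbsianity ∧ EnergyCurrentTails ∧ FastCollisionThroughput (card
local-flux-gibbsianity-ballwise).
LocalFluxGibbsianity (LFG, typed, the ergodic input): for the HOMOGENEOUS (flow-invariant) canonical
hard-sphere Gibbs laws on 𝕋³ at
every small reduced density σ' and Maxwellian (u, θ) in compact boxes there is a tilt size β₀ > 0
such that the window pressure
(M+1)⁻¹ log E exp(X) of the block-recentred, velocity-truncated, COLLISION-RESOLVED current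
functional X — kinetic transport plus the
momentum/energy transfers of the collisions of the a.e. trajectory (finsum over collisionTimes,
pre-collisional left limit, transfer located
on the contact segment), tested against ARBITRARY smooth vector/tensor fields of sup-norm ≤ β₀,
minus the hard-sphere Euler flux of the
block-averaged fields, rate-averaged over a window of L·(M+1)^(-1/3) — has limsup_M ≤ δ for every δ
> 0 once K (velocity cut), then L
(window), then k (block) are large. By convex duality this is LOCAL flux-Gibbsianity: locally
invariant states carry anomalous current at
most β₀⁻¹ × their specific relative entropy — not "stationary ⇒ Gibbs" and not "anomalous current =
0 for all tilts". The two tails items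
(cubic kinetic UI = KineticWindows' EnergyCurrentTails, and vanishing FAST-collision throughput,
both pre-shock under the true law) are the
truncation errors. BallwiseSufficiency (typed implication) turns X into the shared target
RelEntropyVanishing (stmt-0766) by Yau's Gronwall
with BALL-WISE invariant references at the local Euler parameters (entropy mismatch O(r²) + r√h ⇒
H/N = O(r²) for every r), and
EntropyToFields (stmt-0769) gives the conjunct.
Lean: `LocalFluxGibbsianity ∧ EnergyCurrentTails ∧ FastCollisionThroughput`

## Assembly
Pure logic (sorry-free in Sketch.lean, `assembly_holds`): BallwiseSufficiency applied to ⟨LFG,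
tails, throughput⟩ gives RelEntropyVanishing,
and EntropyToFields gives the conjunct
`Literature.MathematicalPhysics.KineticTheory.HydrodynamicLimit` (= `HydrodynamicLimit` of the
sub-problem Statement by `rfl`).

Rationale: WHY THIS LINE. Yau's relative entropy method (Yau1991; OllaVaradhanYau1993 Thm 2.1 with weak noise;
KipnisLandim1999 Ch. 6) needs its ergodic input in ONE
place, the one-block replacement of fast currents; OVY feed it with a classification of all
finite-entropy stationary states (the Boltzmann
hypothesis, stmt-0779 in route RelEntropyErgodic), Bernardin2014 §1.1 notes weaker conditions might
do. The card's move: keep the torus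
Gronwall but, for the one-block term only, cover 𝕋³ by macroscopic balls of radius r and apply the
entropy inequality ball by ball against
the marginal of the INVARIANT homogeneous Gibbs state at the ball's local Euler parameters; the
entropy mismatch is second order
(N_B(Cr² + Cr√h_B)), and under an invariant reference time averaging is free (a large-deviation
pressure of the equilibrium dynamics,
Kifer1990-type duality over invariant states) — so only tilts of size ≤ β₀ are ever probed and the
needed input shrinks to a LINEAR
anomalous-current/entropy bound around each Gibbs state (first order = zero excess Drude weight of
the projected currents, Spohn1991 §7.1,
Doyon2022; second order = bounded current response along invariant directions). Imported areas:
large deviations / convex duality for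
dynamical pressures, linear response. Versus the routes on file: RelEntropyErgodic asks the full
classification (0779); LdDrudeFluxGibbsianity
(opened today) types a GLOBAL-torus LD decay of bounded one-body observables orthogonal to the
collision invariants with a restart-type
sufficiency; KineticWindows restarts from the non-invariant local Gibbs law over finite windows;
this route instead fixes the reference
(invariant, ball-wise), which forces — and this is its technical content — a collision-resolved
current tested against non-gradient tensor
fields (gradient-tested flow differences cannot be localised to balls with O(1) tilts, nor
velocity-truncated without destroying the pair
cancellation that carries the factor ε), block recentring at the hard-sphere equation of state (so
that smooth local-Gibbs tilts cost
entropy but carry no recentred current), and typed tails in the fast-collision-throughput currency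
of card apriori-tails-and-rattlers.

RANKED CRUXES. #0 RelEntropyVanishing (target) — Yau's relative-entropy form of the hydrodynamic
limit (stmt-AtomisticToContinuum-0766 verbatim, shared with RelEntropyErgodic / ChaoticMixing /
VanishingNoise / KineticWindows / LdDrudeFluxGibbsianity): specific relative entropy of the true
time-t law w.r.t. an exponentially concentrating local Gibbs law at the Euler parameters vanishes,
pre-shock, at small reduced density. (why it might fail: entropy production ≥ cN before the first
shock for some smooth data (e.g. implosion-type focusing, card implosion-loophole) refutes every
Yau-type route at once; nothing of the kind is known.) [Yau1991, OllaVaradhanYau1993]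
#2 LocalFluxGibbsianity (crux) — LOCAL FLUX-GIBBSIANITY IN PRESSURE FORM (card crux 1, torus
version). ∃ σ₀ > 0 such that for every parameter box 0 < σlo ≤ σ' ≤ σhi < σ₀, 0 < θlo ≤ θ ≤ θhi, |u|
≤ U there is β₀ > 0 with: for every diameter sequence ε_M > 0 with (M+1)ε_M³ → σ'³, every family of
hard-sphere flows Φ_M of M+1 spheres on 𝕋³, all smooth test fields A₀, A₄ : 𝕋³ → ℝ³ and A : Fin 3 →
𝕋³ → ℝ³ of sup-norm ≤ β₀, and every δ > 0: ∃ K₀ ∀ K ≥ K₀ ∃ L₀ ∀ L ≥ L₀ ∃ k₀ ∀ k ≥ k₀, limsup_M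
(M+1)⁻¹ log ∫ exp(X) dG_M ≤ δ, where G_M = particleLaw(canonicalDensity, constant activity 1,
Maxwellian drift u, temperature θ) is the homogeneous flow-invariant Gibbs law and X = τ⁻¹ [ ∫_0^τ
kin ds + Σ_(collision times s ∈ (0,τ]) coll(γ(s⁻), γ(s)) − ∫_0^τ flux ds ] along γ(s) = Φ_M.flow s
z, with τ = L(M+1)^(-1/3) (micro window), block radius ℓ = k(M+1)^(-1/3): kin = Σ_i 1(|v_i| ≤
K)[⟨A₀(x_i),v_i⟩ + Σ_k ⟨A_k(x_i),v_i⟩ v_i,k + ⟨A₄(x_i),v_i⟩|v_i|²/2] (truncated kinetic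
mass/momentum/energy currents); coll = Σ_i 1(|v_i⁻|,|v_i⁺| ≤ K) (ε/2)∫_0^1 [Σ_k ⟨A_k(x_i − rεω_i),
ω_i⟩ Δ_i,k + ⟨A₄(x_i − rεω_i), ω_i⟩ (|v_i⁺|² − |v_i⁻|²)/2] dr with Δ_i = v_i⁺ − v_i⁻, ω_i =
Δ_i/|Δ_i| (each particle's half of the collisional momentum/energy transfer, located on the contact
segment; vanishes for non-colliding i); flux = (M+1)∫_𝕋³ [⟨A₀,m̄⟩ + Σ_k(⟨A_k,m̄⟩ū_k + p̄ (A_k)_k) +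
⟨A₄,ū⟩(ē + p̄)] dx, the hard-sphere Euler flux of the truncated block fields (ρ̄, m̄, ē) =
cone-kernel averages at radius ℓ of (1, v, |v|²/2) over particles with |v| ≤ K, ū = m̄/ρ̄, θ̄ =
(2/3)(ē/ρ̄ − |ū|²/2), p̄ = ρ̄ θ̄ Z(min(ρ̄,2)σ'³), Z = hsCompressibility. Dual reading (informal crux
InvariantStateLFG, filed after open): locally invariant states of the infinite dynamics near g_U
carry block-recentred anomalous current ≤ β₀⁻¹ × specific relative entropy. [difficulty:
open-problem] (why it might fail: a SOFT anomalous mode — invariant states ν_n → g_U with recentred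
current e ~ s^γ, γ < 1 (excess Drude weight of stress/heat flux, or unbounded 2nd-order response) —
gives limsup > 0 for all β₀, as for the ideal gas and d = 1 rods; or anomalous window LD of the
truncated virial.) [OllaVaradhanYau1993, Spohn1991, Bernardin2014, Kifer1990, Doyon2022,
BuragoFerlegerKononenko1998]
#3 EnergyCurrentTails (crux) — uniform integrability, in the mean under the true law and before the
first shock, of the cubic velocity moments (stmt-AtomisticToContinuum-3655 verbatim, filed by route
KineticWindows; the corrected form of 0781): ∀ t < T ∀ ε > 0 ∃ M ∃ N₀ ∀ N ≥ N₀ ∀ s ≤ t, E[(N+1)⁻¹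
Σ_i |v_i(s)|³ 1(|v_i(s)| > M)] ≤ ε. Controls the kinetic truncation error and the locality tails of
BallwiseSufficiency. [difficulty: open-problem] (why it might fail: the deterministic flow could
focus energy ≍ N^(2/3) on O(1) particles with non-vanishing probability — invisible to entropy
(sub-exponential LD cost of cubic tails) and to domination by Gibbs; no Povzner/maximum principle
for the N-body hard-sphere flow is known.) [NachtergaeleYau2003, OllaVaradhanYau1993, Spohn1991]
#4 FastCollisionThroughput (crux) — VANISHING FAST-COLLISION THROUGHPUT under the true law,
pre-shock (the collisional truncation error of LFG's functional, in the currency of card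
apriori-tails-and-rattlers): for continuous profiles ∃ σ₀ ∀ σ < σ₀ ∀ classical hs-Euler solutions on
[0,T) ∀ flow families, if the local Gibbs fields converge at t = 0 then ∀ t < T ∀ η > 0 ∃ K ∃ N₀ ∀ N
≥ N₀: (N+1)^(-4/3) E[ Σ_i Σ_(collision times s ≤ t) 1(max(|v_i(s⁻)|,|v_i(s)|) > K) (1 +
|v_i(s)+v_i(s⁻)|/2) |v_i(s) − v_i(s⁻)| ] ≤ η (normalisation: (N+1)^(4/3) = order of the total number
of collisions on [0,t]; the summand vanishes unless i collides at s). [difficulty: L] (why it might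
fail: needs collision-RATE control of fast particles under the non-equilibrium law (contact pair
densities of f_t around fast spheres); channelled fast spheres or transient dense clusters could
carry O(1) throughput at polynomially small probability, which entropy bounds cannot see.)
[BuragoFerlegerKononenko1998, GST2013, Alexander1975, NachtergaeleYau2003]
#5 BallwiseSufficiency (crux) — THE BALL-WISE SUFFICIENCY THEOREM (card crux 2 made an implication,
X → target): LocalFluxGibbsianity ∧ EnergyCurrentTails ∧ FastCollisionThroughput →
RelEntropyVanishing. Proof plan: Yau's Gronwall for H(f_t | ψ_t) on the torus with ψ_t the local
Gibbs law driven by the classical solution; quadratic remainder by static LD; for the one-block term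
tile [0,t] by micro windows L(N+1)^(-1/3), cover 𝕋³ by balls of radius r with a partition of unity
χ_B, test the collision-resolved recentred current against χ_B∇λ_t (non-gradient, sup-norm ≤ β₀
after choosing the entropy-inequality parameter a = β₀/sup|∇λ_t|), apply the entropy inequality
ball-wise to the B⁺-marginal of f_t against the marginal of the homogeneous Gibbs law of an
(M+1)-sphere torus system with M+1 ≈ ρ_B(N+1) and parameters (σρ_B^(1/3), u_B, θ_B) on an r-grid;
entropy mismatch ≤ N_B(h_B + Cr² + Cr√h_B) + o(N_B) (second order in r; cross term via the static
entropy inequality), Σ_B N_B h_B ≤ C_ov H + o(N) (superadditivity for near-product hard-core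
references), microscopic locality of X_B over the window from deterministic light cones for
particles slower than K plus items 3–4, pressures from LFG, and d(H/N)/dt ≤ C₁H/N + C₂r² + C₃r√(H/N)
+ δ ⇒ limsup_N H(t)/N ≤ A(t)(r² + δ) for all r, δ. Static inputs (LocalGibbsConcentration 0767,
HsEosLowDensity 0768, virial EOS identification 0782-type) are consumed as separately filed support
items / --supports lemmas. [deps: LocalFluxGibbsianity, EnergyCurrentTails, FastCollisionThroughput]
[difficulty: XL] (why it might fail: window locality under f_t with only cubic-UI tails, the o(N_B)
hard-core boundary/ensemble corrections for ball marginals, the parameter/time grids and the inverse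
equation of state for a_t must all close at o(N); any of these may demand more than items 3–4
supply.) [Yau1991, OllaVaradhanYau1993, KipnisLandim1999, Spohn1991]
#9 EntropyToFields (support) — RelEntropyVanishing → HydrodynamicLimit by the entropy inequality
μ(A) ≤ (log 2 + H(μ|λ))/log(1 + 1/λ(A)) and lawAt = map (flow t) (stmt-AtomisticToContinuum-0769
verbatim). [difficulty: provable-now] [KipnisLandim1999, Yau1991]

TWO-LAYER PLAN. Foreseen glued splits (none filed now): LocalFluxGibbsianity ⇐ InvariantStateLFG
(duality upper bound over locally invariant states, needs the
infinite-volume definitions requested by LdDrudeFluxGibbsianity / 0779) → LinearisedLFG (zero excess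
Drude weight of the projected currents +
ℋ-valued invariant tangents of entropy-vanishing invariant states; first typed rung = route's own
FastObservableMeanErgodic-type L² statement
and the stationary-shear instance of card stationary-shear-rung) → SecondOrderResponse →
LocalFluxGibbsianity; BallwiseSufficiency ⇐
WindowLocality → BallMarginalMismatch → GronwallClosure (k ≤ 3, depth 1). The δ^(7/3) ACOUSTIC
corollary of the card (small-amplitude data,
linearised hs-Euler, from the L² rung + a third-cumulant bound) is a special-case target to file
when LinearisedLFG is typed.

KILL CRITERIA. ¬LocalFluxGibbsianity closes the route outright (close --reason
refuted:LocalFluxGibbsianity): e.g. a family of translation-invariant,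
flow-invariant, finite-entropy states of infinite 3-d hard spheres at small packing approaching a
Gibbs state with anisotropic stress or
heat flux ≫ their specific relative entropy (a soft anomalous mode; this also kills 0779, LdDrude's
KineticFluxLdDecay and ChaoticMixing's
premise), or an N-growing plateau of (M+1)⁻¹ log E_G exp(X) in L at fixed small β₀.
¬FastCollisionThroughput or ¬EnergyCurrentTails with
LFG standing ⇒ pivot: restate BallwiseSufficiency with Gaussian-moment tails
(Literature.Barriers.AtomisticToContinuum.HighMomentumCutoff σ,
pre-shock) as hypothesis. ¬RelEntropyVanishing closes this and every Yau-family route.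
RelEntropyVanishing proved elsewhere moots items 5 and 9
but not LFG as mathematics; KineticFluxLdDecay (LdDrude) proved does NOT moot LFG (different
functional: collisional part, tensor tests).

NOT DECOMPOSED YET. The invariant-state (dual) form of LFG and its linear/second-order rungs (wait
for the infinite-volume definitions); the locality lemma, the
ball-marginal mismatch estimate with hard-core boundary layers, the r-grid of reference parameters
and the time grid of test fields, the
inverse equation of state for a_t (all layer-2 children of BallwiseSufficiency); Galilean/scaling
covariance reductions; the static inputs
0767/0768/0782 (filed in other routes, consumed here); the acoustic corollary. Constants β₀, K₀, L₀,
k₀ are existential on purpose.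

CHEAPEST FALSIFIER. (i) Paper check, one page: run the functional X on the IDEAL GAS (ε-sequence
with σ' → 0 formally, no collisions): kin tested with a
traceless A gives limsup_M (M+1)⁻¹ log E exp(X) = c(θ)·∫|A|² + O(K-tails) > 0 for every L, k — LFG
must fail there and ONLY through the
missing collisions (free transport conserves v⊗v); any other failure mode means the functional is
mis-normalised. Done by hand while
drafting: the block term is centred (∫ of a constant flux against the block fields' fluctuations is
o(M)), the kinetic tilt is a Gaussian
tilt of each velocity, positive pressure ∝ β₀² — as it must be. (ii) MD (kit, not run in this
one-shot seat): N = 10³–10⁵ hard spheres at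
packing 0.05–0.2, finite-size scaling of (M+1)⁻¹ log E_G exp(X) for A = small constant shear tensor
versus L: a plateau growing with N
refutes LFG; published Green–Kubo data (stress autocorrelation integrable, t^(-3/2) tail,
doi:10.1063/1.1673845) predict decay ∝ 1/L.
(iii) Lookup: any printed non-Gibbs translation-invariant stationary state of finite specific
entropy for 3-d hard spheres with
non-Eulerian fluxes (none in OllaVaradhanYau1993, Spohn1991, Bernardin2014).

NUMBERS. Scales (macro units, N+1 spheres of diameter σ(N+1)^(-1/3) on the unit torus): micro length
ι = (M+1)^(-1/3); window τ = Lι (L ≍ number of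
mean free times × σ'²√θ); block radius kι (≈ 4k³ particles); balls of macroscopic radius r → 0 last;
velocity cut K; limits N → ∞, then
K, L, k → ∞ in the order ∀δ ∃K₀ ∀K ∃L₀ ∀L ∃k₀ ∀k, then r → 0. Expected sizes: Λ_L = O(β₀²/L) +
O(L^(-3/2)) (Green–Kubo + long-time tail)
given LFG; entropy mismatch per ball N_B(Cr² + Cr√h_B); Gronwall output limsup_N H(t)/N ≤ A(t) r².
Compressibility cap at normalised block
density 2 (2σ'³ < η₀ of HsEosLowDensity). Items at open: 7 typed (target, 4 cruxes, 1 support,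
assembly) + 1 informal crux filed after open.

DEFINITION REQUESTS. None new. The informal crux InvariantStateLFG (rank 6, filed after open) waits
for the three definitions already requested by route
LdDrudeFluxGibbsianity / item 0779 (InfiniteHardSphereDynamics, HardSphereSpecificRelEntropy,
CollisionalTransferAlongFlow); the typed
items of this route inline the collision-resolved transfer (finsum over
`Literature.Analysis.FluidPDE.collisionTimes` with `Function.leftLim`)
and would shorten once CollisionalTransferAlongFlow lands.

Novelty: Searches (2026-08-15, this seat; remote APIs rate-limited — OpenAlex/S2/arXiv 429, logged): `lit
search --hybrid "relative entropy method
local Gibbs reference invariant measure ball localization hydrodynamic limit Hamiltonian"` (10 held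
books: KipnisLandim1999 Ch. 6,
Spohn1991, SaintRaymond2009, DeMasiPresutti1991, Arkeryd–Lions–Markowich 1993 …; none localises the
reference measure); `lit search
--hybrid "Olla Varadhan Yau hydrodynamical limit Hamiltonian weak noise one block ergodic" --source
local` (6; same books); `lit search
--hybrid "Lagrange Jacobi identity virial hard spheres collisions cluster"` (5; CIP1994 p. 73
collision bounds); `lit galaxy search
"relative entropy method" --star pdf` (6 rows: arXiv:2401.17651 relative entropy for Euler–Poisson,
Lu Xu hyperbolic fluctuations of a
weakly anharmonic chain — PDE/stochastic-chain uses, no localised reference), `lit galaxy search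
"hydrodynamic limit of hard spheres"
--star all` (0), two longer galaxy phrases (0); the card's own audited searches (OVY pp. 3, 15–18;
Spohn1991 pp. 11, 40–46, 53; crossref
sweeps) and today's route files LdDrudeFluxGibbsianity / KineticWindows / FirstFailureBlowup (read
in full for overlap).
Nearest prior art found: OllaVaradhanYau1993 §3–4 (Thm 3.10: the classification is used only for
currents); Sinai's LD-conditional 1-d
Euler derivation reported in Spohn1991 (notes to §3.2); Bernardin2014 §1.1 ("weaker or different
conditions could suffice"); Kifer1990
(LD upper bounds as sup over invar  [refs: 2401.17651, KipnisLandim1999, Spohn1991, SaintRaymond2009, CIP1994, OllaVaradhanYau1993, Bernardin2014, Kifer1990]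

Barriers (technique_class: relative-entropy linear-response large-deviations): - technique_class: relative-entropy linear-response large-deviations
- Literature.Barriers.AtomisticToContinuum.BoltzmannHypothesisBarrier: weakened, not evaded: the
input is "locally invariant states carry anomalous current ≤ C × entropy" (LFG), strictly weaker
than "stationary ⇒ Gibbs mixture" (0779) and than flux-Gibbsianity for all tilts; the barrier's
formal kernel (ideal gas, arbitrary velocity law h: anomalous stress ~ |h−M| at entropy cost ~
|h−M|²) is exactly a case where LFG is false, for the right reason (no collisions); the bet is that
near-equilibrium current rigidity of 3-d hard spheres is provable where classification is not.
- Literature.Barriers.AtomisticToContinuum.BoltzmannHypothesisBarrierNarrow: adopted as frame (the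
method consumes a flux-level closure); LFG is a local, typed, finite-N form of that closure
including the collisional transfer.
- Literature.Barriers.AtomisticToContinuum.MacroErgodicityBarrier: applies in spirit (same missing
input); Bernardin's "weaker conditions" clause is instantiated; no sector condition or spectral gap
at Euler scale is asked.
- Literature.Barriers.AtomisticToContinuum.HighMomentumCutoffBarrier: it does not evade it; the bet
is items 3–4 (cubic UI + fast-collision throughput, pre-shock, in the mean) — weaker than
Nachtergaele–Yau's Gaussian II.1 and exactly what the truncated functional needs; the exponential
moments in LFG are taken of TRUNCATED currents only (the untruncated cubic heat flux has infinite
pressure under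

History (route lifecycle, newest last):
- 2026-08-15T12:41:54Z · CLOSED superseded — superseded:route-AtomisticToContinuum-BallwiseGibbsReferences (planner-plancard-AtomisticToContinuum-Hydrody-86786698-0)

sub-problem: HydrodynamicLimit · status: closed(superseded) · opened planner-plancard-AtomisticToContinuum-Hydrody-86786698-0 2026-08-15T11:46:51Z · rev 3 · ledger route-AtomisticToContinuum-BallwiseFluxGibbsianity
GENERATED by the gate from the ledger (D-0016/17). Provers cite these decls: `theorem foo : Summit.AtomisticToContinuum.HydrodynamicLimit.Theses.BallwiseFluxGibbsianity.<Decl> := …` in Summits/AtomisticToContinuum/HydrodynamicLimit/Theorems/<Name>.lean.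
-/

namespace Summit.AtomisticToContinuum.HydrodynamicLimit.Theses.BallwiseFluxGibbsianity

open scoped BigOperators Topology Manifold Classical MeasureTheory ProbabilityTheory Matrix InnerProductSpace ComplexConjugate ContinuousMap
open Filter Set Function TopologicalSpace MeasureTheory

attribute [summit_statement] _root_.HydrodynamicLimit

/-- item stmt-AtomisticToContinuum-0766 · target · rank 0 · open · by planner
why it might fail: entropy production ≥ cN before the first shock for some smooth data (e.g. implosion-type focusing, card implosion-loophole) refutes every Yau-type route at once; nothing of the kind is known.
sources: Yau1991, OllaVaradhanYau1993
[target] X_RE: for all continuous profiles ∃ σ₀ ∀ σ<σ₀ ∀ classical hs-Euler solutions on [0,T) ∀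
flows: the initial local Gibbs laws are probability measures and, if their fields converge at t=0,
then ∀ t<T ∃ activity profile a_t such that the reference local Gibbs law (a_t, u_t, θ_t) is a
probability measure whose empirical density/momentum/energy fields concentrate exponentially (≤ C
e^{-(N+1)/C}) around (ρ,ρu,E)(t), and klDiv(lawAt Φ_N (localGibbs a₀u₀θ₀) t ‖ localGibbs a_t u_t
θ_t)/(N+1) → 0. Yau1991; OllaVaradhanYau1993 Thm 1.1 (with noise). -/
@[route_item "route-AtomisticToContinuum-BallwiseFluxGibbsianity"]
def RelEntropyVanishing : Prop :=
  ∀ (a₀ θ₀ : Literature.MathematicalPhysics.KineticTheory.T3 → ℝ) (u₀ : Literature.MathematicalPhysics.KineticTheory.T3 → Literature.MathematicalPhysics.KineticTheory.V3), Continuous a₀ → Continuous θ₀ → Continuous u₀ → (∀ x, 0 < a₀ x) → (∀ x, 0 < θ₀ x) → ∃ σ₀ : ℝ, 0 < σ₀ ∧ ∀ σ : ℝ, 0 < σ → σ < σ₀ → ∀ (T : ℝ) (ρ θ : ℝ → Literature.MathematicalPhysics.KineticTheory.T3 → ℝ) (u : ℝ → Literature.MathematicalPhysics.KineticTheory.T3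 → Literature.MathematicalPhysics.KineticTheory.V3), Literature.MathematicalPhysics.KineticTheory.IsHardSphereEulerSolution σ T ρ u θ → ∀ Φ : (N : ℕ) → Literature.Analysis.FluidPDE.HardSphereFlow (Literature.Analysis.FluidPDE.Torus.geometry (Fin 3)) (Literature.MathematicalPhysics.KineticTheory.hsDiameter σ N) (N + 1), (∀ N, MeasureTheory.IsProbabilityMeasure (Literature.MathematicalPhysics.KineticTheory.localGibbsLaw σ a₀ u₀ θ₀ N (Φ N))) ∧ (Literature.MathematicalPhysics.KineticTheory.TendstoHydroFieldsAt (fun N => Literature.MathematicalPhysics.KineticTheory.localGibbsLaw σ a₀ u₀ θ₀ N (Φ N)) Φ ρ u θ 0 → ∀ t ∈ Set.Ico 0 T, ∃ a : Literature.MathematicalPhysics.KineticTheory.T3 → ℝ, (∀ N, MeasureTheory.IsProbabilityMeasure (Literature.MathematicalPhysics.KineticTheory.localGibbsLaw σ a (u t) (θ t) N (Φ N))) ∧ (∀ χ : Literature.MathematicalPhysics.KineticTheory.T3 → ℝ, Continuous χ → ∀ δ : ℝ, 0 < δ → ∃ C : ℝ, 0 < C ∧ ∀ N : ℕ, Literature.MathematicalPhysics.KineticTheory.localGibbsLaw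 σ a (u t) (θ t) N (Φ N) {z | δ < |Literature.MathematicalPhysics.KineticTheory.empiricalDensityField z χ - ∫ x, χ x * ρ t x|} ≤ ENNReal.ofReal (C * Real.exp (-(C⁻¹ * (N + 1)))) ∧ Literature.MathematicalPhysics.KineticTheory.localGibbsLaw σ a (u t) (θ t) N (Φ N) {z | δ < ‖Literature.MathematicalPhysics.KineticTheory.empiricalMomentumField z χ - ∫ x, (χ x * ρ t x) • u t x‖} ≤ ENNReal.ofReal (C * Real.exp (-(C⁻¹ * (N + 1)))) ∧ Literature.MathematicalPhysics.KineticTheory.localGibbsLaw σ a (u t) (θ t) N (Φ N) {z | δ < |Literature.MathematicalPhysics.KineticTheory.empiricalEnergyField z χ - ∫ x, χ x * Literature.MathematicalPhysics.KineticTheory.totalEnergyDensity (ρ t x) (u t x) (θ t x)|} ≤ ENNReal.ofReal (C * Real.exp (-(C⁻¹ * (N + 1))))) ∧ Filter.Tendsto (fun N : ℕ => InformationTheory.klDiv ((Φ N).lawAt (Literature.MathematicalPhysics.KineticTheory.localGibbsLaw σ a₀ u₀ θ₀ N (Φ N)) t) (Literature.MathematicalPhysics.KineticTheory.localGibbsLaw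 σ a (u t) (θ t) N (Φ N)) / ((N : ENNReal) + 1)) Filter.atTop (nhds 0))

/-- item stmt-AtomisticToContinuum-6454 · crux · rank 2 · closed · moot by None · by planner
why it might fail: a SOFT anomalous mode — invariant states ν_n → g_U with recentred current e ~ s^γ, γ < 1 (excess Drude weight of stress/heat flux, or unbounded 2nd-order response) — gives limsup > 0 for all β₀, as for the ideal gas and d = 1 rods; or anomalous window LD of the truncated virial.
sources: OllaVaradhanYau1993, Spohn1991, Bernardin2014, Kifer1990, Doyon2022, BuragoFerlegerKononenko1998
[crux] LOCAL FLUX-GIBBSIANITY IN PRESSURE FORM (card crux 1, torus version). ∃ σ₀ > 0 such that for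
every parameter box 0 < σlo ≤ σ' ≤ σhi < σ₀, 0 < θlo ≤ θ ≤ θhi, |u| ≤ U there is β₀ > 0 with: for
every diameter sequence ε_M > 0 with (M+1)ε_M³ → σ'³, every family of hard-sphere flows Φ_M of M+1
spheres on 𝕋³, all smooth test fields A₀, A₄ : 𝕋³ → ℝ³ and A : Fin 3 → 𝕋³ → ℝ³ of sup-norm ≤ β₀, and
every δ > 0: ∃ K₀ ∀ K ≥ K₀ ∃ L₀ ∀ L ≥ L₀ ∃ k₀ ∀ k ≥ k₀, limsup_M (M+1)⁻¹ log ∫ exp(X) dG_M ≤ δ,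
where G_M = particleLaw(canonicalDensity, constant activity 1, Maxwellian drift u, temperature θ) is
the homogeneous flow-invariant Gibbs law and X = τ⁻¹ [ ∫_0^τ kin ds + Σ_(collision times s ∈ (0,τ])
coll(γ(s⁻), γ(s)) − ∫_0^τ flux ds ] along γ(s) = Φ_M.flow s z, with τ = L(M+1)^(-1/3) (micro
window), block radius ℓ = k(M+1)^(-1/3): kin = Σ_i 1(|v_i| ≤ K)[⟨A₀(x_i),v_i⟩ + Σ_k ⟨A_k(x_i),v_i⟩
v_i,k + ⟨A₄(x_i),v_i⟩|v_i|²/2] (truncated kinetic mass/momentum/energy currents); coll = Σ_i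
1(|v_i⁻|,|v_i⁺| ≤ K) (ε/2)∫_0^1 [Σ_k ⟨A_k(x_i − rεω_i), ω_i⟩ Δ_i,k + ⟨A₄(x_i − rεω_i), ω_i⟩ (|v_i⁺|²
− |v_i⁻|²)/2] dr with Δ_i = v_i⁺ − v_i⁻, ω_i = Δ_i/|Δ_i| (each particle's half of the collisional
momentum/energy trans -/
@[route_item "route-AtomisticToContinuum-BallwiseFluxGibbsianity"]
def LocalFluxGibbsianity : Prop :=
  ∃ σ₀ : ℝ, 0 < σ₀ ∧ ∀ (σlo σhi θlo θhi U : ℝ), 0 < σlo → σhi < σ₀ → 0 < θlo → ∃ β₀ : ℝ, 0 < β₀ ∧ ∀ σ' ∈ Set.Icc σlo σhi, ∀ θ ∈ Set.Icc θlo θhi, ∀ u : EuclideanSpace ℝ (Fin 3), ‖u‖ ≤ U → ∀ ε : ℕ → ℝ, (∀ M, 0 < ε M) → Filter.Tendsto (fun M : ℕ => ((M : ℝ) + 1) * ε M ^ 3) Filter.atTop (nhds (σ' ^ 3)) → ∀ Φ : (M : ℕ) → Literature.Analysis.FluidPDE.HardSphereFlow (Literature.Analysis.FluidPDE.Torus.geometry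 (Fin 3)) (ε M) (M + 1), ∀ (A₀ A₄ : UnitAddTorus (Fin 3) → EuclideanSpace ℝ (Fin 3)) (A : Fin 3 → UnitAddTorus (Fin 3) → EuclideanSpace ℝ (Fin 3)), Literature.Analysis.FunctionSpaces.Torus.IsSmooth A₀ → Literature.Analysis.FunctionSpaces.Torus.IsSmooth A₄ → (∀ k, Literature.Analysis.FunctionSpaces.Torus.IsSmooth (A k)) → (∀ x, ‖A₀ x‖ ≤ β₀) → (∀ x, ‖A₄ x‖ ≤ β₀) → (∀ k x, ‖A k x‖ ≤ β₀) → ∀ δ : ℝ, 0 < δ → ∃ K₀ : ℝ, ∀ K ≥ K₀, ∃ L₀ : ℝ, ∀ L ≥ L₀, ∃ k₀ : ℝ, ∀ k ≥ k₀, Filter.limsup (fun M : ℕ => let τ : ℝ := L * ((M : ℝ) + 1) ^ (-(1 / 3 : ℝ)); let bk : UnitAddTorus (Fin 3) → UnitAddTorus (Fin 3) → ℝ := fun x y => 3 / (Real.pi * (k * ((M : ℝ) + 1) ^ (-(1 / 3 : ℝ))) ^ 3) * max 0 (1 - Literature.Analysis.FluidPDE.Torus.euclidDist x y / (k * ((M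 : ℝ) + 1) ^ (-(1 / 3 : ℝ)))); let kin : (Fin (M + 1) → UnitAddTorus (Fin 3) × EuclideanSpace ℝ (Fin 3)) → ℝ := fun z => ∑ i, if ‖(z i).2‖ ≤ K then ⟪A₀ (z i).1, (z i).2⟫_ℝ + (∑ j, ⟪A j (z i).1, (z i).2⟫_ℝ * (z i).2 j) + ⟪A₄ (z i).1, (z i).2⟫_ℝ * ‖(z i).2‖ ^ 2 / 2 else 0; let coll : (Fin (M + 1) → UnitAddTorus (Fin 3) × EuclideanSpace ℝ (Fin 3)) → (Fin (M + 1) → UnitAddTorus (Fin 3) × EuclideanSpace ℝ (Fin 3)) → ℝ := fun zl zr => ∑ i, (let Δ : EuclideanSpace ℝ (Fin 3) := (zr i).2 - (zl i).2; let ω : EuclideanSpace ℝ (Fin 3) := ‖Δ‖⁻¹ • Δ; if ‖(zl i).2‖ ≤ K ∧ ‖(zr i).2‖ ≤ K then ε M / 2 * ∫ r in (0 : ℝ)..1, ((∑ j, ⟪A j ((zr i).1 + Literature.Analysis.FunctionSpaces.Torus.proj (-(r * ε M) • ω)), ω⟫_ℝ * Δ j) + ⟪A₄ ((zr i).1 +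 Literature.Analysis.FunctionSpaces.Torus.proj (-(r * ε M) • ω)), ω⟫_ℝ * (‖(zr i).2‖ ^ 2 - ‖(zl i).2‖ ^ 2) / 2) else 0); let flux : (Fin (M + 1) → UnitAddTorus (Fin 3) × EuclideanSpace ℝ (Fin 3)) → ℝ := fun z => ((M : ℝ) + 1) * ∫ x, (let ρ : ℝ := ((M : ℝ) + 1)⁻¹ * ∑ i, (if ‖(z i).2‖ ≤ K then bk x (z i).1 else 0); let m : EuclideanSpace ℝ (Fin 3) := ((M : ℝ) + 1)⁻¹ • ∑ i, (if ‖(z i).2‖ ≤ K then bk x (z i).1 • (z i).2 else 0); let e : ℝ := ((M : ℝ) + 1)⁻¹ * ∑ i, (if ‖(z i).2‖ ≤ K then bk x (z i).1 * ‖(z i).2‖ ^ 2 / 2 else 0); let w : EuclideanSpace ℝ (Fin 3) := ρ⁻¹ • m; let p : ℝ := ρ * (2 / 3 * (e / ρ - ‖w‖ ^ 2 / 2)) * Literature.MathematicalPhysics.KineticTheory.hsCompressibility (min ρ 2 * σ' ^ 3); ⟪A₀ x, m⟫_ℝ + (∑ j, (⟪A j x, m⟫_ℝ * w j + p * A j x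 j)) + ⟪A₄ x, w⟫_ℝ * (e + p)); ((((M : ℝ) + 1)⁻¹ : ℝ) : EReal) * ENNReal.log (∫⁻ z, ENNReal.ofReal (Real.exp (τ⁻¹ * ((∫ s in (0 : ℝ)..τ, kin ((Φ M).flow s z)) + (∑ᶠ s ∈ Literature.Analysis.FluidPDE.collisionTimes (Literature.Analysis.FluidPDE.Torus.geometry (Fin 3)) (ε M) (fun s => (Φ M).flow s z) ∩ Set.Ioc 0 τ, coll (Function.leftLim (fun s => (Φ M).flow s z) s) ((Φ M).flow s z)) - ∫ s in (0 : ℝ)..τ, flux ((Φ M).flow s z)))) ∂(Literature.Analysis.FluidPDE.particleLaw (Φ M) (Literature.Analysis.FluidPDE.canonicalDensity (Literature.Analysis.FluidPDE.Torus.geometry (Fin 3)) (ε M) (M + 1) (Literature.MathematicalPhysics.KineticTheory.localGibbsProfile (fun _ => 1) (fun _ => u) (fun _ => θ)))))) Filter.atTop ≤ (δ : EReal)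

/-- item stmt-AtomisticToContinuum-3655 · crux · rank 3 · closed · moot by None · by planner
why it might fail: the deterministic flow could focus energy ≍ N^(2/3) on O(1) particles with non-vanishing probability — invisible to entropy (sub-exponential LD cost of cubic tails) and to domination by Gibbs; no Povzner/maximum principle for the N-body hard-sphere flow is known.
sources: NachtergaeleYau2003, OllaVaradhanYau1993, Spohn1991
[crux] UNIFORM INTEGRABILITY OF THE ENERGY-CURRENT TAILS BEFORE THE FIRST SHOCK (card crux 3's
irreducible tail input; the consumable, corrected form of RelEntropyErgodic's LargeVelocityControl
0781, whose exponential-cubic-moment wording is false already at t = 0). For continuous profiles ∃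
σ₀ ∀ σ ∈ (0,σ₀) ∀ classical hs-Euler solutions (ρ,u,θ) on [0,T) ∀ flow families Φ_N: if the local
Gibbs fields converge at t = 0 to (ρ,ρu,E)(0), then ∀ t < T ∀ ε > 0 ∃ M ∃ N₀ ∀ N ≥ N₀ ∀ s ∈ [0,t]:
E_{λ^N}[(N+1)⁻¹ Σ_i |v_i(s)|³ 1{|v_i(s)| > M}] ≤ ε, v_i(s) the velocities of (Φ_N.flow s z). On
pre-shock horizons it follows from the catalogued open hypothesis
Literature.Barriers.AtomisticToContinuum.HighMomentumCutoff σ (Nachtergaele–Yau II.1 transcribed),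
which is NOT assumed here (the item is weaker: cubic uniform integrability in mean, pre-shock only,
σ₀ profile-dependent). [difficulty: open-problem] -/
@[route_item "route-AtomisticToContinuum-BallwiseFluxGibbsianity"]
def EnergyCurrentTails : Prop :=
  ∀ (a₀ θ₀ : Literature.MathematicalPhysics.KineticTheory.T3 → ℝ) (u₀ : Literature.MathematicalPhysics.KineticTheory.T3 → Literature.MathematicalPhysics.KineticTheory.V3), Continuous a₀ → Continuous θ₀ → Continuous u₀ → (∀ x, 0 < a₀ x) → (∀ x, 0 < θ₀ x) → ∃ σ₀ : ℝ, 0 < σ₀ ∧ ∀ σ : ℝ, 0 < σ → σ < σ₀ → ∀ (T : ℝ) (ρ θ : ℝ → Literature.MathematicalPhysics.KineticTheory.T3 → ℝ) (u : ℝ → Literature.MathematicalPhysics.KineticTheory.T3 → Literature.MathematicalPhysics.KineticTheory.V3), Literature.MathematicalPhysics.KineticTheory.IsHardSphereEulerSolution σ T ρ u θ → ∀ Φ : (N : ℕ) → Literature.Analysis.FluidPDE.HardSphereFlow (Literature.Analysis.FluidPDE.Torus.geometry (Fin 3)) (Literature.MathematicalPhysics.KineticTheory.hsDiameter σ N) (N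 + 1), Literature.MathematicalPhysics.KineticTheory.TendstoHydroFieldsAt (fun N => Literature.MathematicalPhysics.KineticTheory.localGibbsLaw σ a₀ u₀ θ₀ N (Φ N)) Φ ρ u θ 0 → ∀ t ∈ Set.Ico 0 T, ∀ ε : ℝ, 0 < ε → ∃ M : ℝ, ∃ N₀ : ℕ, ∀ N : ℕ, N₀ ≤ N → ∀ s ∈ Set.Icc 0 t, ∫⁻ z, ENNReal.ofReal (((N : ℝ) + 1)⁻¹ * ∑ i : Fin (N + 1), Set.indicator {v : Literature.MathematicalPhysics.KineticTheory.V3 | M < ‖v‖} (fun v => ‖v‖ ^ 3) (((Φ N).flow s z i).2)) ∂(Literature.MathematicalPhysics.KineticTheory.localGibbsLaw σ a₀ u₀ θ₀ N (Φ N)) ≤ ENNReal.ofReal ε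

/-- item stmt-AtomisticToContinuum-6455 · crux · rank 4 · closed · moot by None · by planner
why it might fail: needs collision-RATE control of fast particles under the non-equilibrium law (contact pair densities of f_t around fast spheres); channelled fast spheres or transient dense clusters could carry O(1) throughput at polynomially small probability, which entropy bounds cannot see.
sources: BuragoFerlegerKononenko1998, GST2013, Alexander1975, NachtergaeleYau2003
[crux] VANISHING FAST-COLLISION THROUGHPUT under the true law, pre-shock (the collisional truncation
error of LFG's functional, in the currency of card apriori-tails-and-rattlers): for continuous
profiles ∃ σ₀ ∀ σ < σ₀ ∀ classical hs-Euler solutions on [0,T) ∀ flow families, if the local Gibbs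
fields converge at t = 0 then ∀ t < T ∀ η > 0 ∃ K ∃ N₀ ∀ N ≥ N₀: (N+1)^(-4/3) E[ Σ_i Σ_(collision
times s ≤ t) 1(max(|v_i(s⁻)|,|v_i(s)|) > K) (1 + |v_i(s)+v_i(s⁻)|/2) |v_i(s) − v_i(s⁻)| ] ≤ η
(normalisation: (N+1)^(4/3) = order of the total number of collisions on [0,t]; the summand vanishes
unless i collides at s). [difficulty: L] -/
@[route_item "route-AtomisticToContinuum-BallwiseFluxGibbsianity"]
def FastCollisionThroughput : Prop :=
  ∀ (a₀ θ₀ : Literature.MathematicalPhysics.KineticTheory.T3 → ℝ) (u₀ : Literature.MathematicalPhysics.KineticTheory.T3 → Literature.MathematicalPhysics.KineticTheory.V3), Continuous a₀ → Continuous θ₀ → Continuous u₀ → (∀ x, 0 < a₀ x) → (∀ x, 0 < θ₀ x) → ∃ σ₀ : ℝ, 0 < σ₀ ∧ ∀ σ : ℝ, 0 < σ → σ < σ₀ → ∀ (T : ℝ) (ρ θ : ℝ → Literature.MathematicalPhysics.KineticTheory.T3 → ℝ) (u : ℝ → Literature.MathematicalPhysics.KineticTheory.T3 → Literature.MathematicalPhysics.KineticTheory.V3),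 Literature.MathematicalPhysics.KineticTheory.IsHardSphereEulerSolution σ T ρ u θ → ∀ Φ : (N : ℕ) → Literature.Analysis.FluidPDE.HardSphereFlow (Literature.Analysis.FluidPDE.Torus.geometry (Fin 3)) (Literature.MathematicalPhysics.KineticTheory.hsDiameter σ N) (N + 1), Literature.MathematicalPhysics.KineticTheory.TendstoHydroFieldsAt (fun N => Literature.MathematicalPhysics.KineticTheory.localGibbsLaw σ a₀ u₀ θ₀ N (Φ N)) Φ ρ u θ 0 → ∀ t ∈ Set.Ico 0 T, ∀ η : ℝ, 0 < η → ∃ K : ℝ, ∃ N₀ : ℕ, ∀ N : ℕ, N₀ ≤ N → ∫⁻ z, ENNReal.ofReal ((((N : ℝ) + 1) ^ (-(4 / 3 : ℝ))) * ∑ i : Fin (N + 1), ∑ᶠ s ∈ Literature.Analysis.FluidPDE.collisionTimes (Literature.Analysis.FluidPDE.Torus.geometry (Fin 3)) (Literature.MathematicalPhysics.KineticTheory.hsDiameter σ N) (fun s => (Φ N).flow s z) ∩ Set.Ioc 0 t, (if K < max ‖(Function.leftLim (fun s => (Φ N).flow s z) s i).2‖ ‖((Φ N).flow s z i).2‖ then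 (1 + ‖((Φ N).flow s z i).2 + (Function.leftLim (fun s => (Φ N).flow s z) s i).2‖ / 2) * ‖((Φ N).flow s z i).2 - (Function.leftLim (fun s => (Φ N).flow s z) s i).2‖ else 0)) ∂(Literature.MathematicalPhysics.KineticTheory.localGibbsLaw σ a₀ u₀ θ₀ N (Φ N)) ≤ ENNReal.ofReal η

-- TODO item stmt-AtomisticToContinuum-6456 · crux · rank 5 · closed · moot by None · by planner — BLOCKED: missing decl(s) RelEntropyVanishing; restate via `ledger route edit` once they land:
--   def BallwiseSufficiency : Prop := LocalFluxGibbsianity ∧ EnergyCurrentTails ∧ FastCollisionThroughput → RelEntropyVanishing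

-- TODO item stmt-AtomisticToContinuum-6457 · assembly · rank 1 · closed · moot by None · by planner — BLOCKED: missing decl(s) EntropyToFields; restate via `ledger route edit` once they land:
--   def Assembly2 : Prop := LocalFluxGibbsianity → EnergyCurrentTails → FastCollisionThroughput → BallwiseSufficiency → Assembly → Literature.MathematicalPhysics.KineticTheory.HydrodynamicLimit

/-- item stmt-AtomisticToContinuum-0769 · assembly · rank 9 · open · by planner
[assembly] X_RE → HydrodynamicLimit: entropy inequality μ(A) ≤ (log 2 + H(μ|λ))/log(1 + 1/λ(A))
(from Donsker–Varadhan / Mathlib klDiv API) with λ(A) ≤ C e^{-(N+1)/C} and H = o(N) gives μ(A) → 0;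
μ = lawAt (Φ N) P t = P.map (flow t) turns μ{z | δ < |field z − ·|} into P{z | δ < |field (flow t z)
− ·|} (measurable_flow); the reference concentration is stated for z itself and TendstoHydroFieldsAt
at time 0 of the reference law is not needed. Zero-mass case impossible by the IsProbabilityMeasure
clauses; take σ₀ from X_RE. -/
@[route_item "route-AtomisticToContinuum-BallwiseFluxGibbsianity"]
def Assembly : Prop :=
  RelEntropyVanishing → Literature.MathematicalPhysics.KineticTheory.HydrodynamicLimit

end Summit.AtomisticToContinuum.HydrodynamicLimit.Theses.BallwiseFluxGibbsianity
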